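import Summits.Ventures.Crystal3D.Theorems.StickyWulffConstantNoReconstructionGainNoK1122
import HarnessLib

/-!
# Five regular tetrahedra around a common edge do not close up (criminal anatomy brick, line `replication-exactness`)

HONEST FRAMING. Part of the venture `Summits/Ventures/Crystal3D` (cell `crystal3d-full`), helper `--supports` the
crux `NoReconstructionGain` (stmt-Ventures-19144, route `route-Ventures-StickyWulffConstant`), lead wulff-p1 g19.  The
fourth forbidden contact pattern (after `K₅`, `K_{1,1,2,2}` = a closed 4-ring around a bond, `K₆ − K₃`): a CLOSED 5-RING
around a bond — two touching balls `u, a` and five common neighbours `c₀,…,c₄` with `cᵢ` touching `cᵢ₊₁` cyclically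
(the pentagonal bipyramid with all ten ring/axis contacts AND all five ring contacts; classically the `7.36°` gap of five
regular tetrahedra sharing an edge).  Hence the common neighbours of a bond of a unit-ball packing never carry a cycle of
contacts (3-cycle: `K₅`; 4-cycle: `no_K1122_contacts`; 5-cycle: this file; ≥ 6 common neighbours do not fit).

* `no_closed_five_ring` — proof: with `u` as origin the unit vectors `A = a − u`, `Bᵢ = cᵢ − u` have `⟪A,Bᵢ⟫ = ⟪Bᵢ,Bᵢ₊₁⟫
  = 1/2`, so `inner_eq_one_or_eq_neg_third` gives `⟪Bᵢ, Bᵢ₊₂⟫ = −1/3` (the `cᵢ` being distinct from `cᵢ₊₂`); then the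
  rational vector `10B₀ − 8B₁ + 3B₂ + 3B₃ − 8B₄` has squared norm `100·(246 − 199 − 152/3)/100 < 0`.

WHAT THIS IS NOT: nothing about films by itself; rung F-C1 not moved.
-/

noncomputable section

namespace Summit.Ventures.Crystal3D.Theorems

open scoped InnerProductSpace

/-- **No closed ring of five balls around a bond.**  There are no points `u, a, c₀, …, c₄` of `ℝ³` with `cᵢ ≠ cᵢ₊₂`
(indices mod 5) and the unit distances `ua`, `ucᵢ`, `acᵢ`, `cᵢcᵢ₊₁`. -/
theorem no_closed_five_ring (u a c₀ c₁ c₂ c₃ c₄ : EuclideanSpace ℝ (Fin 3))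
    (h02 : c₀ ≠ c₂) (h13 : c₁ ≠ c₃) (h24 : c₂ ≠ c₄) (h30 : c₃ ≠ c₀) (h41 : c₄ ≠ c₁)
    (hua : dist u a = 1)
    (hu0 : dist u c₀ = 1) (hu1 : dist u c₁ = 1) (hu2 : dist u c₂ = 1) (hu3 : dist u c₃ = 1) (hu4 : dist u c₄ = 1)
    (ha0 : dist a c₀ = 1) (ha1 : dist a c₁ = 1) (ha2 : dist a c₂ = 1) (ha3 : dist a c₃ = 1) (ha4 : dist a c₄ = 1)
    (r01 : dist c₀ c₁ = 1) (r12 : dist c₁ c₂ = 1) (r23 : dist c₂ c₃ = 1) (r34 : dist c₃ c₄ = 1)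
    (r40 : dist c₄ c₀ = 1) : False := by
  set A := a - u with hA
  set B₀ := c₀ - u with hB₀
  set B₁ := c₁ - u with hB₁
  set B₂ := c₂ - u with hB₂
  set B₃ := c₃ - u with hB₃
  set B₄ := c₄ - u with hB₄
  have nrm : ∀ {p : EuclideanSpace ℝ (Fin 3)}, dist u p = 1 → ‖p - u‖ = 1 := by
    intro p h; rwa [← dist_eq_norm, dist_comm]
  have nA : ‖A‖ = 1 := nrm hua
  have n0 : ‖B₀‖ = 1 := nrm hu0
  have n1 : ‖B₁‖ = 1 := nrm hu1
  have n2 : ‖B₂‖ = 1 := nrm hu2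
  have n3 : ‖B₃‖ = 1 := nrm hu3
  have n4 : ‖B₄‖ = 1 := nrm hu4
  have sub : ∀ p q : EuclideanSpace ℝ (Fin 3), (q - u) - (p - u) = q - p := fun p q => by abel
  have tri : ∀ {p q : EuclideanSpace ℝ (Fin 3)}, dist p q = 1 → ‖p - u‖ = 1 → ‖q - u‖ = 1 →
      ⟪p - u, q - u⟫_ℝ = 1 / 2 := by
    intro p q h hp hq
    refine inner_eq_half_of_unit_triangle hp hq ?_
    rw [sub, ← dist_eq_norm, dist_comm, h]
  have a0 : ⟪A, B₀⟫_ℝ = 1 / 2 := tri ha0 nA n0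
  have a1 : ⟪A, B₁⟫_ℝ = 1 / 2 := tri ha1 nA n1
  have a2 : ⟪A, B₂⟫_ℝ = 1 / 2 := tri ha2 nA n2
  have a3 : ⟪A, B₃⟫_ℝ = 1 / 2 := tri ha3 nA n3
  have a4 : ⟪A, B₄⟫_ℝ = 1 / 2 := tri ha4 nA n4
  have b01 : ⟪B₀, B₁⟫_ℝ = 1 / 2 := tri r01 n0 n1
  have b12 : ⟪B₁, B₂⟫_ℝ = 1 / 2 := tri r12 n1 n2
  have b23 : ⟪B₂, B₃⟫_ℝ = 1 / 2 := tri r23 n2 n3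
  have b34 : ⟪B₃, B₄⟫_ℝ = 1 / 2 := tri r34 n3 n4
  have b40 : ⟪B₄, B₀⟫_ℝ = 1 / 2 := tri r40 n4 n0
  -- skip-one inner products are `−1/3`
  have skip : ∀ {X Y Z : EuclideanSpace ℝ (Fin 3)} {x z : EuclideanSpace ℝ (Fin 3)}, X = x - u → Z = z - u → x ≠ z →
      ‖X‖ = 1 → ‖Y‖ = 1 → ‖Z‖ = 1 → ⟪A, X⟫_ℝ = 1 / 2 → ⟪A, Y⟫_ℝ = 1 / 2 → ⟪A, Z⟫_ℝ = 1 / 2 →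
      ⟪X, Y⟫_ℝ = 1 / 2 → ⟪Y, Z⟫_ℝ = 1 / 2 → ⟪X, Z⟫_ℝ = -1 / 3 := by
    intro X Y Z x z hX hZ hne nX nY nZ hAX hAY hAZ hXY hYZ
    rcases inner_eq_one_or_eq_neg_third nA nX nY nZ hAX hAY hAZ hXY
      (by rw [real_inner_comm]; exact hYZ) with h | h
    · exfalso; apply hne
      have e := norm_sub_sq_real X Z
      rw [nX, nZ, h] at e
      have h0 : ‖X - Z‖ ^ 2 = 0 := by rw [e]; norm_num
      rw [sq_eq_zero_iff, norm_eq_zero, sub_eq_zero, hX, hZ] at h0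
      simpa using congrArg (· + u) h0
    · exact h
  have s02 : ⟪B₀, B₂⟫_ℝ = -1 / 3 := skip hB₀ hB₂ h02 n0 n1 n2 a0 a1 a2 b01 b12
  have s13 : ⟪B₁, B₃⟫_ℝ = -1 / 3 := skip hB₁ hB₃ h13 n1 n2 n3 a1 a2 a3 b12 b23
  have s24 : ⟪B₂, B₄⟫_ℝ = -1 / 3 := skip hB₂ hB₄ h24 n2 n3 n4 a2 a3 a4 b23 b34
  have s30 : ⟪B₃, B₀⟫_ℝ = -1 / 3 := skip hB₃ hB₀ h30 n3 n4 n0 a3 a4 a0 b34 b40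
  have s41 : ⟪B₄, B₁⟫_ℝ = -1 / 3 := skip hB₄ hB₁ h41 n4 n0 n1 a4 a0 a1 b40 b01
  have q0 : ⟪B₀, B₀⟫_ℝ = 1 := by rw [real_inner_self_eq_norm_sq, n0]; norm_num
  have q1 : ⟪B₁, B₁⟫_ℝ = 1 := by rw [real_inner_self_eq_norm_sq, n1]; norm_num
  have q2 : ⟪B₂, B₂⟫_ℝ = 1 := by rw [real_inner_self_eq_norm_sq, n2]; norm_num
  have q3 : ⟪B₃, B₃⟫_ℝ = 1 := by rw [real_inner_self_eq_norm_sq, n3]; norm_num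
  have q4 : ⟪B₄, B₄⟫_ℝ = 1 := by rw [real_inner_self_eq_norm_sq, n4]; norm_num
  have c10 : ⟪B₁, B₀⟫_ℝ = 1 / 2 := by rw [real_inner_comm]; exact b01
  have c21 : ⟪B₂, B₁⟫_ℝ = 1 / 2 := by rw [real_inner_comm]; exact b12
  have c32 : ⟪B₃, B₂⟫_ℝ = 1 / 2 := by rw [real_inner_comm]; exact b23
  have c43 : ⟪B₄, B₃⟫_ℝ = 1 / 2 := by rw [real_inner_comm]; exact b34
  have c04 : ⟪B₀, B₄⟫_ℝ = 1 / 2 := by rw [real_inner_comm]; exact b40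
  have c20 : ⟪B₂, B₀⟫_ℝ = -1 / 3 := by rw [real_inner_comm]; exact s02
  have c31 : ⟪B₃, B₁⟫_ℝ = -1 / 3 := by rw [real_inner_comm]; exact s13
  have c42 : ⟪B₄, B₂⟫_ℝ = -1 / 3 := by rw [real_inner_comm]; exact s24
  have c03 : ⟪B₀, B₃⟫_ℝ = -1 / 3 := by rw [real_inner_comm]; exact s30
  have c14 : ⟪B₁, B₄⟫_ℝ = -1 / 3 := by rw [real_inner_comm]; exact s41
  -- the rational test vector `10B₀ − 8B₁ + 3B₂ + 3B₃ − 8B₄` has negative Gram value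
  set v := (10 : ℝ) • B₀ - (8 : ℝ) • B₁ + (3 : ℝ) • B₂ + (3 : ℝ) • B₃ - (8 : ℝ) • B₄ with hv
  have e0 : ⟪B₀, v⟫_ℝ = 0 := by
    rw [hv]; simp only [inner_add_right, inner_sub_right, real_inner_smul_right]
    rw [q0, b01, s02, c03, c04]; norm_num
  have e1 : ⟪B₁, v⟫_ℝ = 1 / 6 := by
    rw [hv]; simp only [inner_add_right, inner_sub_right, real_inner_smul_right]
    rw [c10, q1, b12, s13, c14]; norm_num
  have e2 : ⟪B₂, v⟫_ℝ = -1 / 6 := by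
    rw [hv]; simp only [inner_add_right, inner_sub_right, real_inner_smul_right]
    rw [c20, c21, q2, b23, s24]; norm_num
  have e3 : ⟪B₃, v⟫_ℝ = -1 / 6 := by
    rw [hv]; simp only [inner_add_right, inner_sub_right, real_inner_smul_right]
    rw [s30, c31, c32, q3, b34]; norm_num
  have e4 : ⟪B₄, v⟫_ℝ = 1 / 6 := by
    rw [hv]; simp only [inner_add_right, inner_sub_right, real_inner_smul_right]
    rw [b40, s41, c42, c43, q4]; norm_num
  have hvv : ⟪v, v⟫_ℝ = 10 * ⟪B₀, v⟫_ℝ - 8 * ⟪B₁, v⟫_ℝ + 3 * ⟪B₂, v⟫_ℝ + 3 * ⟪B₃, v⟫_ℝ - 8 * ⟪B₄, v⟫_ℝ := by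
    nth_rw 1 [hv]
    simp only [inner_add_left, inner_sub_left, real_inner_smul_left]
  have hnn : 0 ≤ ⟪v, v⟫_ℝ := real_inner_self_nonneg
  rw [hvv, e0, e1, e2, e3, e4] at hnn
  norm_num at hnn

end Summit.Ventures.Crystal3D.Theorems

end
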